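import Mathlib
import Summits.Ventures.HodgeRepro2.T5HodgeStar
import Summits.Ventures.HodgeRepro2.T5L2Positivity

/-!
# T5TwoZeroPositivity — the Hodge–Riemann positivity on `(2,0)`-forms, in the coframe model

Kernel support (blind cell pub-hodge-repro2, seat p6) for route/T5-N1-hodge-p6.md §H3 («the
form `(α, β) = ∫_S α ∧ β̄` is a positive definite hermitian form on `H^{2,0}(S)`», Voisin
Theorem 6.32 with `k = n = 2`, `(p, q) = (2, 0)`) and §H2.2, composed from the two model files
T5HodgeStar (p389464: the pointwise identity `α ∧ β̄ = (α, β)_s Vol_s` in the orthonormal coframe)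
and T5L2Positivity (p398478: the L² norm of a continuous function against a measure of full
support vanishes only if the function does).

Model. In the orthonormal coframe `(dx₁, dy₁, dx₂, dy₂)` at a point every `(2,0)`-covector is
`twoZero b = b • dz₁ ∧ dz₂` (T5HodgeStar); a `(2,0)`-form on a region of the surface trivialised
by such a coframe is a continuous coefficient function `a : S → ℂ`, `α_s = twoZero (a s)`, and the
4-form `α ∧ β̄` is `wedge (twoZero (a s)) (conjC (twoZero (b s))) · Vol_s`.  Integrating against
the volume measure `μ = Vol_S` (finite on compacts, positive on non-empty open sets) gives the
period `∫_S α ∧ β̄`.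

* `wedge_twoZero_conjC`: `α ∧ β̄ = 4 a b̄ Vol` pointwise (memo H2.1's constant check);
* `wedge_twoZero_conjC_self_nonneg`, `wedge_twoZero_conjC_self_eq_zero_iff`: the pointwise
  Hodge–Riemann positivity `α ∧ ᾱ = 4 |a|² Vol ≥ 0`, `= 0 ⟺ α_s = 0`;
* `integral_wedge`, `integral_wedge_self`: `∫ α ∧ β̄ = 4 ∫ a b̄`, `∫ α ∧ ᾱ = 4 ∫ |a|²`;
* `integral_wedge_self_eq_zero_iff`, `integral_wedge_self_re_pos_iff`: **§H3 / §H2.2**: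
  `∫_S α ∧ ᾱ = 0 ⟺ α = 0`, `∫_S α ∧ ᾱ > 0 ⟺ α ≠ 0` for a continuous coefficient `a`;
* `integral_wedge_smul_ne_zero_iff`: **§H5 in the period form**: for `β = c • α`,
  `∫_S α ∧ β̄ ≠ 0 ⟺ c ≠ 0 ∧ α ≠ 0`.

All declarations: Mathlib + own T5HodgeStar + own T5L2Positivity, no `sorry`,
axioms ⊆ {propext, Classical.choice, Quot.sound}.
-/

namespace Summit.Ventures.HodgeRepro2.T5TwoZeroPositivity

open MeasureTheory
open Summit.Ventures.HodgeRepro2.T5HodgeStar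
open Summit.Ventures.HodgeRepro2.T5L2Positivity

/-! ### Pointwise: `α ∧ β̄ = 4 a b̄ Vol` and Hodge–Riemann positivity -/

/-- `α ∧ β̄ = 4 a b̄ · Vol` for `α = a dz₁∧dz₂`, `β = b dz₁∧dz₂` (T5HodgeStar `wedge_conjC_twoZero`
+ `herm_twoZero`; the constant check of memo H2.1). -/
theorem wedge_twoZero_conjC (a b : ℂ) :
    wedge (twoZero a) (conjC (twoZero b)) = 4 * a * (starRingEnd ℂ) b := by
  rw [wedge_conjC_twoZero, herm_twoZero]

/-- `α ∧ ᾱ = 4 ‖a‖² · Vol`: the coefficient is real and non-negative. -/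
theorem wedge_twoZero_conjC_self (a : ℂ) :
    wedge (twoZero a) (conjC (twoZero a)) = ((4 * ‖a‖ ^ 2 : ℝ) : ℂ) := by
  rw [wedge_twoZero_conjC, mul_assoc, Complex.mul_conj, Complex.normSq_eq_norm_sq]
  push_cast
  ring

/-- **Pointwise Hodge–Riemann positivity** (Voisin Theorem 6.32 for `(p, q) = (2, 0)` in the
model): the coefficient of `α ∧ ᾱ` is real and `≥ 0`. -/
theorem wedge_twoZero_conjC_self_re_nonneg (a : ℂ) :
    0 ≤ (wedge (twoZero a) (conjC (twoZero a))).re := by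
  rw [wedge_twoZero_conjC_self, Complex.ofReal_re]
  positivity

/-- The coefficient of `α ∧ ᾱ` is `0` iff the covector `α_s` is `0` (i.e. `a = 0`). -/
theorem wedge_twoZero_conjC_self_eq_zero_iff (a : ℂ) :
    wedge (twoZero a) (conjC (twoZero a)) = 0 ↔ a = 0 := by
  rw [wedge_twoZero_conjC_self, Complex.ofReal_eq_zero]
  simp only [mul_eq_zero, OfNat.ofNat_ne_zero, false_or, pow_eq_zero_iff, ne_eq,
    not_false_eq_true, norm_eq_zero]

/-! ### Global: the period `∫_S α ∧ β̄` -/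

variable {S : Type*} [MeasurableSpace S] {μ : Measure S}

/-- `∫_S α ∧ β̄ = 4 ∫_S a b̄ dμ` for the `(2,0)`-forms with coefficients `a, b`. -/
theorem integral_wedge (a b : S → ℂ) :
    ∫ s, wedge (twoZero (a s)) (conjC (twoZero (b s))) ∂μ
      = 4 * ∫ s, a s * (starRingEnd ℂ) (b s) ∂μ := by
  simp_rw [wedge_twoZero_conjC, mul_assoc]
  rw [← smul_eq_mul, ← integral_smul]
  simp only [smul_eq_mul]

/-- `∫_S α ∧ ᾱ = 4 ∫_S ‖a‖² dμ` — real, and the L² norm of the coefficient. -/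
theorem integral_wedge_self (a : S → ℂ) :
    ∫ s, wedge (twoZero (a s)) (conjC (twoZero (a s))) ∂μ
      = ((4 * ∫ s, ‖a s‖ ^ 2 ∂μ : ℝ) : ℂ) := by
  simp_rw [wedge_twoZero_conjC_self]
  rw [integral_complex_ofReal, integral_const_mul]

/-- The period `∫_S α ∧ ᾱ` is real. -/
theorem integral_wedge_self_im (a : S → ℂ) :
    (∫ s, wedge (twoZero (a s)) (conjC (twoZero (a s))) ∂μ).im = 0 := by
  rw [integral_wedge_self]
  exact Complex.ofReal_im _

/-- The period `∫_S α ∧ ᾱ` is `≥ 0` (§H3, «(α, α) ≥ 0»). -/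
theorem integral_wedge_self_re_nonneg (a : S → ℂ) :
    0 ≤ (∫ s, wedge (twoZero (a s)) (conjC (twoZero (a s))) ∂μ).re := by
  rw [integral_wedge_self, Complex.ofReal_re]
  have := integral_nonneg_of_nonneg (μ := μ) (q := fun s => ‖a s‖ ^ 2) fun s => by positivity
  positivity

variable [TopologicalSpace S] [OpensMeasurableSpace S] [CompactSpace S]
  [IsFiniteMeasureOnCompacts μ] [μ.IsOpenPosMeasure]

/-- **§H3 / §H2.2: `∫_S α ∧ ᾱ = 0 ⟺ α = 0`** for a `(2,0)`-form with continuous coefficient `a`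
on the compact `S` (the L² norm of `a` vanishes only if `a` does: T5L2Positivity). -/
theorem integral_wedge_self_eq_zero_iff {a : S → ℂ} (ha : Continuous a) :
    ∫ s, wedge (twoZero (a s)) (conjC (twoZero (a s))) ∂μ = 0 ↔ a = 0 := by
  rw [integral_wedge_self, Complex.ofReal_eq_zero, mul_eq_zero, integral_normSq_eq_zero_iff ha]
  simp only [OfNat.ofNat_ne_zero, false_or]

/-- **§H3: `∫_S α ∧ ᾱ > 0 ⟺ α ≠ 0`** — the Hodge–Riemann form is positive definite on the
`(2,0)`-forms of the model. -/
theorem integral_wedge_self_re_pos_iff {a : S → ℂ} (ha : Continuous a) :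
    0 < (∫ s, wedge (twoZero (a s)) (conjC (twoZero (a s))) ∂μ).re ↔ a ≠ 0 := by
  rw [integral_wedge_self, Complex.ofReal_re, ← integral_normSq_pos_iff (μ := μ) ha]
  constructor <;> intro h <;> linarith

/-- **§H5 in the period form.** If `β = c • α` (the two `(2,0)`-forms lie on one line), then
`∫_S α ∧ β̄ ≠ 0 ⟺ c ≠ 0 ∧ α ≠ 0`. -/
theorem integral_wedge_smul_ne_zero_iff {a : S → ℂ} (ha : Continuous a) (c : ℂ) :
    ∫ s, wedge (twoZero (a s)) (conjC (twoZero (c * a s))) ∂μ ≠ 0 ↔ c ≠ 0 ∧ a ≠ 0 := by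
  have h : (fun s => wedge (twoZero (a s)) (conjC (twoZero (c * a s))))
      = fun s => (starRingEnd ℂ) c * wedge (twoZero (a s)) (conjC (twoZero (a s))) := by
    funext s
    rw [wedge_twoZero_conjC, wedge_twoZero_conjC, map_mul]
    ring
  rw [h, integral_const_mul, mul_ne_zero_iff, map_ne_zero]
  simp only [ne_eq, integral_wedge_self_eq_zero_iff ha]

end Summit.Ventures.HodgeRepro2.T5TwoZeroPositivity
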